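import Literature.NumberTheory.LFunctions.ExplicitKthDerivTest
import Literature.NumberTheory.LFunctions.ZetaDualPhaseFifthBounds
import Literature.NumberTheory.LFunctions.VanDerCorputBProcess
import HarnessLib

/-!
# The `A³B(0,1)` step of Patel–Yang's Lemma 3.4: the fifth-derivative test on the dual sum

Topic `Literature/NumberTheory/LFunctions`. Patel–Yang 2024, proof of Lemma 3.4, §"Applying the
`A³B(0,1)` process", eq. (3.13): for the dual phase `φ_r(ν) = g_r(x_ν) - νx_ν` of the differenced
logarithmic phase `g_r` on a block `(a, b]`, `b ≤ ha`, the partial sums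
`S_{φ_r}(⌊α⌋, L) = ∑_{⌊α⌋<ν≤L} e(φ_r(ν))`, `α = g_r'(b-r) < L ≤ β = g_r'(a)`, are bounded by Yang's
explicit fifth-derivative test (Lemma 1.4 / `…kthDerivTest_yang`, `k = 5`) with
`λ₅ ≤ |φ_r⁽⁵⁾| ≤ h₅λ₅`. We PROVE this with the tree's order-`5` dual family
(`…dualFamily5`, `…dualFamily5_derivFamily`) and the box bounds
`…neg_dualFamily5_five_bounds` (`λ₅' = (105/16)a⁹/(h²K⁴r⁴)`, `h₅' = h¹³`, `K = t/2π`):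
`‖S_{φ_r}(⌊α⌋, L)‖ ≤ 1 + yangKRHS η h¹³ 5 (β - α) λ₅'`
(the `1` accounts for the term `ν = ⌊α⌋ + 1`, whose stationary point may fall outside the block).

## References

* D. Patel, A. Yang, *An explicit sub-Weyl bound for `ζ(1/2 + it)`*, J. Number Theory 262 (2024),
  proof of Lemma 3.4, (3.12)–(3.13). [cite: PatelYang2024, Lemma 3.4]
-/

noncomputable section

open Real Set

namespace Literature.NumberTheory.LFunctions
namespace VdC

/-- `yangKRHS` is non-decreasing in `N ≥ 0` (`j ≥ 3`, `λ > 0`). [folklore] -/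
theorem yangKRHS_mono {η h : ℝ} (hη : 0 < η) (hh : 1 ≤ h) {j : ℕ} (hj : 3 ≤ j) {N₁ N₂ lam : ℝ}
    (h0 : 0 ≤ N₁) (h12 : N₁ ≤ N₂) (hlam : 0 < lam) :
    yangKRHS η h j N₁ lam ≤ yangKRHS η h j N₂ lam := by
  unfold yangKRHS
  have hA := yangA_pos hη hh j hj
  have hB := yangB_pos hη j hj
  have hh0 : 0 < h := by linarith
  have hJ := four_le_yangJ hj
  have hexp : 0 ≤ 1 - 2 / yangJ j := by
    rw [sub_nonneg, div_le_one (by linarith)]; linarith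
  have h1 : N₁ ^ (1 - 2 / yangJ j) ≤ N₂ ^ (1 - 2 / yangJ j) := Real.rpow_le_rpow h0 h12 hexp
  gcongr

/-- **The fifth-derivative test on the dual partial sums** (Patel–Yang (3.13), with the box
constants `λ₅' = (105/16)a⁹/(h²K⁴r⁴)`, `h₅' = h¹³`): for `t > 0`, `r > 0`, `0 < a`, `a + r ≤ b ≤ ha`,
`1 ≤ h`, `η > 0`, `α = g_r'(b-r)`, `β = g_r'(a)`, and every integer `L` with `⌊α⌋ < L ≤ β`,
`‖∑_{⌊α⌋<ν≤L} e(ψ(ν))‖ ≤ 1 + yangKRHS η h¹³ 5 (β - α) λ₅'`. [cite: PatelYang2024, Lemma 3.4] -/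
theorem dualSum_fifthTest {t r a b h η : ℝ} (ht : 0 < t) (hr : 0 < r) (ha : 0 < a) (harb : a + r ≤ b)
    (hb : b ≤ h * a) (hh : 1 ≤ h) (hη : 0 < η) {L : ℤ} (hL1 : ⌊dphase t r 1 (b - r)⌋ < L)
    (hL2 : (L : ℝ) ≤ dphase t r 1 a) :
    ‖∑ ν ∈ Finset.Ioc ⌊dphase t r 1 (b - r)⌋ L, e (dualFamily5 t r 0 ν)‖
      ≤ 1 + yangKRHS η (h ^ 13) 5 (dphase t r 1 a - dphase t r 1 (b - r))
          (105 / 16 * a ^ 9 / (h ^ 2 * (t / (2 * π)) ^ 4 * r ^ 4)) := by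
  set α : ℝ := dphase t r 1 (b - r) with hαdef
  set β : ℝ := dphase t r 1 a with hβdef
  set lam : ℝ := 105 / 16 * a ^ 9 / (h ^ 2 * (t / (2 * π)) ^ 4 * r ^ 4) with hlamdef
  have hK : 0 < t / (2 * π) := by positivity
  have hh0 : 0 < h := by linarith
  have hlam : 0 < lam := by positivity
  have hbr : a ≤ b - r := by linarith
  have hbr0 : 0 < b - r := lt_of_lt_of_le ha hbr
  have hα0 : 0 < α := by
    rw [hαdef, dphase_one]
    have : (b - r + r)⁻¹ < (b - r)⁻¹ := by
      apply inv_strictAnti₀ hbr0; linarith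
    nlinarith
  have hαβ : α ≤ β := by
    rcases hbr.lt_or_eq with hlt | heq
    · exact (dphase_one_strictAnti ht hr ha hlt).le
    · rw [hαdef, hβdef, heq]
  have hh13 : 1 ≤ h ^ 13 := one_le_pow₀ hh
  set N : ℤ := ⌊α⌋ with hN
  have hN1 : α < ((N + 1 : ℤ) : ℝ) := by push_cast; exact Int.lt_floor_add_one α
  have hRHS0 : 0 ≤ yangKRHS η (h ^ 13) 5 (β - α) lam :=
    yangKRHS_nonneg hη hh13 (by norm_num) (by linarith) hlam
  -- split off the first term `ν = N + 1`
  have hsplit : Finset.Ioc N L = Finset.cons (N + 1) (Finset.Ioc (N + 1) L)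
      (by simp) := by
    ext n
    simp only [Finset.mem_Ioc, Finset.mem_cons]
    omega
  rw [hsplit, Finset.sum_cons]
  refine (norm_add_le _ _).trans (add_le_add ?_ ?_)
  · rw [norm_e]
  rcases le_or_gt L (N + 1) with hle | hlt
  · rw [Finset.Ioc_eq_empty (by omega), Finset.sum_empty, norm_zero]; exact hRHS0
  -- the fifth-derivative test on `(N+1, L]`
  have hN1pos : (0 : ℝ) < ((N + 1 : ℤ) : ℝ) := hα0.trans hN1
  have hD : DerivFamily (dualFamily5 t r) ((N + 1 : ℤ) : ℝ) (L : ℝ) 5 :=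
    dualFamily5_derivFamily ht hr hN1pos
  have hbd : ∀ y ∈ Icc (((N + 1 : ℤ)) : ℝ) (L : ℝ),
      lam ≤ -dualFamily5 t r 5 y ∧ -dualFamily5 t r 5 y ≤ h ^ 13 * lam := by
    intro y hy
    have hy0 : 0 < y := hN1pos.trans_le hy.1
    have hyα : α < y := hN1.trans_le hy.1
    have hyβ : y ≤ β := hy.2.trans hL2
    have hx := xsLog_mem_Icc ht hr ha hyα hyβ hbr
    exact neg_dualFamily5_five_bounds ht hr ha hh hy0 hx.1 (by linarith [hx.2])
  have htest := kthDerivTest_yang hη hh13 (by norm_num : 3 ≤ 5) hlt hlam hD (Or.inr hbd)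
  refine htest.trans (yangKRHS_mono hη hh13 (by norm_num) ?_ ?_ hlam)
  · have : ((N + 1 : ℤ) : ℝ) ≤ (L : ℝ) := by exact_mod_cast hlt.le
    linarith
  · linarith

/-- Lower bound for `-g_r''` at the right end of the block: `-g_r''(b-r) = K((b-r)⁻² - b⁻²) ≥ 2Kr/b³`
(`r < b`). [cite: PatelYang2024, Lemma 3.4] -/
theorem neg_dphase_two_end_ge {t r b : ℝ} (ht : 0 < t) (hr : 0 < r) (hrb : r < b) :
    2 * (t / (2 * π)) * r / b ^ 3 ≤ -dphase t r 2 (b - r) := by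
  have hK : 0 < t / (2 * π) := by positivity
  have hb : 0 < b := hr.trans hrb
  have hbr : 0 < b - r := by linarith
  rw [dphase_two, sub_add_cancel]
  have e1 : -(-(t / (2 * π)) * (((b - r) ^ 2)⁻¹ - (b ^ 2)⁻¹))
      = (t / (2 * π)) * (r * (2 * b - r) / ((b - r) ^ 2 * b ^ 2)) := by
    field_simp; ring
  rw [e1, show 2 * (t / (2 * π)) * r / b ^ 3 = (t / (2 * π)) * (2 * r / b ^ 3) by ring]
  refine mul_le_mul_of_nonneg_left ?_ hK.le
  rw [div_le_div_iff₀ (by positivity) (by positivity)]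
  have h1 : 0 ≤ r * (3 * b - 2 * r) := by nlinarith
  nlinarith [mul_nonneg (mul_nonneg h1 hr.le) (sq_nonneg b), sq_nonneg (b - r), hb.le]

/-- **The weighted dual sum of the `B`-process for `g_r` on a block** (Patel–Yang (3.14) with our
constants): by partial summation (`abel_bound`, weights `w(ν) = |g_r''(x_ν)|^{-1/2}` non-increasing,
`w ≤ (2Kr/(ha)³)^{-1/2}` since `-g_r''(x_ν) ≥ -g_r''(b-r) ≥ 2Kr/b³`) and `…dualSum_fifthTest`.
Hypotheses: `t > 0`, `0 < r`, `0 < a`, `a + r ≤ b ≤ ha`, `1 ≤ h`, `η > 0`.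
[cite: PatelYang2024, Lemma 3.4] -/
theorem weightedDualSum_le {t r a b h η : ℝ} (ht : 0 < t) (hr : 0 < r) (ha : 0 < a)
    (harb : a + r ≤ b) (hb : b ≤ h * a) (hh : 1 ≤ h) (hη : 0 < η) :
    ‖∑ ν ∈ Finset.Ioc ⌊dphase t r 1 (b - r)⌋ ⌊dphase t r 1 a⌋,
        (((Real.sqrt (-dphase t r 2 (xsLog t r ν)))⁻¹ : ℝ) : ℂ)
          * e (dphase t r 0 (xsLog t r ν) - ν * xsLog t r ν)‖
      ≤ (Real.sqrt (2 * (t / (2 * π)) * r / (h * a) ^ 3))⁻¹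
        * (1 + yangKRHS η (h ^ 13) 5 (dphase t r 1 a - dphase t r 1 (b - r))
          (105 / 16 * a ^ 9 / (h ^ 2 * (t / (2 * π)) ^ 4 * r ^ 4))) := by
  set α : ℝ := dphase t r 1 (b - r) with hαdef
  set β : ℝ := dphase t r 1 a with hβdef
  set B : ℝ := 1 + yangKRHS η (h ^ 13) 5 (β - α)
    (105 / 16 * a ^ 9 / (h ^ 2 * (t / (2 * π)) ^ 4 * r ^ 4)) with hBdef
  have hK : 0 < t / (2 * π) := by positivity
  have hh0 : 0 < h := by linarith
  have hbr : a ≤ b - r := by linarith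
  have hbr0 : 0 < b - r := lt_of_lt_of_le ha hbr
  have hb0 : 0 < b := by linarith
  have hα0 : 0 < α := by
    rw [hαdef, dphase_one]
    have : (b - r + r)⁻¹ < (b - r)⁻¹ := by
      apply inv_strictAnti₀ hbr0; linarith
    nlinarith
  have hαβ : α ≤ β := by
    rcases hbr.lt_or_eq with hlt | heq
    · exact (dphase_one_strictAnti ht hr ha hlt).le
    · rw [hαdef, hβdef, heq]
  have hβ0 : 0 < β := hα0.trans_le hαβ
  have hh13 : 1 ≤ h ^ 13 := one_le_pow₀ hh
  have hB0 : 0 ≤ B := by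
    have := yangKRHS_nonneg hη hh13 (by norm_num : 3 ≤ 5) (by linarith : 0 ≤ β - α)
      (by positivity : 0 < 105 / 16 * a ^ 9 / (h ^ 2 * (t / (2 * π)) ^ 4 * r ^ 4))
    rw [hBdef]; linarith
  have hlam2 : 0 < 2 * (t / (2 * π)) * r / (h * a) ^ 3 := by positivity
  -- pass to natural indices
  set N : ℕ := ⌊α⌋₊ with hN
  set Nb : ℕ := ⌊β⌋₊ with hNb
  have hNz : (⌊α⌋ : ℤ) = (N : ℤ) := (Int.natCast_floor_eq_floor hα0.le).symm
  have hNbz : (⌊β⌋ : ℤ) = (Nb : ℤ) := (Int.natCast_floor_eq_floor hβ0.le).symm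
  have hNα : α < N + 1 := Nat.lt_floor_add_one α
  have hNbβ : (Nb : ℝ) ≤ β := Nat.floor_le hβ0.le
  rw [hNz, hNbz, sum_Ioc_int_eq_nat]
  simp only [Int.cast_natCast]
  rcases le_or_gt Nb N with hle | hlt
  · rw [Finset.Ioc_eq_empty (by omega), Finset.sum_empty, norm_zero]; positivity
  obtain ⟨mm, hmm⟩ : ∃ mm, Nb = N + mm := ⟨Nb - N, by omega⟩
  rw [hmm]
  have hpart : ∀ x, N < x → x ≤ N + mm →
      ‖∑ n ∈ Finset.Ioc N x, e (dualFamily5 t r 0 n)‖ ≤ B := by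
    intro x hx1 hx2
    have h1 : (⌊α⌋ : ℤ) < (x : ℤ) := by rw [hNz]; exact_mod_cast hx1
    have h2 : ((x : ℤ) : ℝ) ≤ β := by
      have : (x : ℝ) ≤ Nb := by rw [hmm]; exact_mod_cast hx2
      push_cast; exact this.trans hNbβ
    have h := dualSum_fifthTest ht hr ha harb hb hh hη h1 h2
    rw [hNz, sum_Ioc_int_eq_nat] at h
    simpa only [Int.cast_natCast] using h
  have hab := abel_bound (fun n => e (dualFamily5 t r 0 n)) N hB0 mm
    (fun n => (Real.sqrt (-dphase t r 2 (xsLog t r n)))⁻¹)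
    (fun n₁ n₂ h1 h12 _ => weight_antitone ht hr
      (by exact_mod_cast (show 0 < n₁ by omega)) (by exact_mod_cast h12))
    (fun n _ _ => inv_nonneg.2 (Real.sqrt_nonneg _)) (inv_nonneg.2 (Real.sqrt_nonneg _)) hpart
  have hform : ∑ n ∈ Finset.Ioc N (N + mm),
      (((Real.sqrt (-dphase t r 2 (xsLog t r n)))⁻¹ : ℝ) : ℂ)
        * e (dphase t r 0 (xsLog t r n) - n * xsLog t r n)
      = ∑ n ∈ Finset.Ioc N (N + mm),
        (((Real.sqrt (-dphase t r 2 (xsLog t r n)))⁻¹ : ℝ) : ℂ) * e (dualFamily5 t r 0 n) := rfl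
  rw [hform]
  refine hab.trans (mul_le_mul_of_nonneg_right ?_ hB0)
  -- `w(N+1) ≤ (2Kr/(ha)³)^{-1/2}`
  have hν1 : α < ((N + 1 : ℕ) : ℝ) := by push_cast; exact hNα
  have hν2 : ((N + 1 : ℕ) : ℝ) ≤ β := by
    have : ((N + 1 : ℕ) : ℝ) ≤ Nb := by exact_mod_cast (show N + 1 ≤ Nb by omega)
    exact this.trans hNbβ
  have hxI := xsLog_mem_Icc ht hr ha hν1 hν2 hbr
  have hx0 : 0 < xsLog t r ((N + 1 : ℕ) : ℝ) := lt_of_lt_of_le ha hxI.1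
  have hmono := neg_dphase_two_antitone ht hr hx0 hxI.2
  have hend := neg_dphase_two_end_ge ht hr (by linarith : r < b)
  have hb3 : 2 * (t / (2 * π)) * r / (h * a) ^ 3 ≤ 2 * (t / (2 * π)) * r / b ^ 3 := by
    apply div_le_div_of_nonneg_left (by positivity) (by positivity)
    exact pow_le_pow_left₀ hb0.le hb 3
  show (Real.sqrt (-dphase t r 2 (xsLog t r ((N + 1 : ℕ) : ℝ))))⁻¹
    ≤ (Real.sqrt (2 * (t / (2 * π)) * r / (h * a) ^ 3))⁻¹
  exact inv_anti₀ (Real.sqrt_pos.2 hlam2) (Real.sqrt_le_sqrt (by linarith))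

/-! ### The `B`-process for `g_r` on the block (Patel–Yang (3.16)) -/

/-- `-g_r'' ≤ 2Kr/y³` and `|g_r⁽³⁾| ≤ 6Kr/y⁴` (`y > 0`, `r > 0`). [folklore] -/
theorem dphase_two_three_abs_le {t r y : ℝ} (ht : 0 < t) (hr : 0 < r) (hy : 0 < y) :
    -dphase t r 2 y ≤ 2 * (t / (2 * π)) * r / y ^ 3 ∧ |dphase t r 3 y| ≤ 6 * (t / (2 * π)) * r / y ^ 4 := by
  have hK : 0 < t / (2 * π) := by positivity
  have hyr : 0 < y + r := by linarith
  set p : ℝ := y⁻¹ with hp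
  set q : ℝ := (y + r)⁻¹ with hq
  have hp0 : 0 < p := inv_pos.2 hy
  have hq0 : 0 < q := inv_pos.2 hyr
  have hqp : q ≤ p := by rw [hp, hq]; exact inv_anti₀ hy (by linarith)
  have hpq : p - q = r * p * q := by
    rw [hp, hq, inv_sub_inv_add_eq hy hyr]; field_simp
  have h2 : -dphase t r 2 y = (t / (2 * π)) * ((p - q) * (p + q)) := by
    rw [dphase_two, hp, hq, ← inv_pow, ← inv_pow]; ring
  have h3 : dphase t r 3 y = 2 * (t / (2 * π)) * ((p - q) * (p ^ 2 + p * q + q ^ 2)) := by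
    rw [dphase_three, hp, hq, ← inv_pow, ← inv_pow]; ring
  have hy3 : 2 * (t / (2 * π)) * r / y ^ 3 = 2 * (t / (2 * π)) * r * p ^ 3 := by
    rw [hp, inv_pow]; ring
  have hy4 : 6 * (t / (2 * π)) * r / y ^ 4 = 6 * (t / (2 * π)) * r * p ^ 4 := by
    rw [hp, inv_pow]; ring
  constructor
  · rw [h2, hpq, hy3]
    have h1 : q * (p + q) ≤ 2 * p ^ 2 := by nlinarith
    have := mul_le_mul_of_nonneg_left h1 (by positivity : 0 ≤ (t / (2 * π)) * r * p)
    nlinarith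
  · rw [h3, hpq, hy4, abs_of_pos (by positivity)]
    have h1 : q * (p ^ 2 + p * q + q ^ 2) ≤ 3 * p ^ 3 := by nlinarith [mul_pos hp0 hq0]
    have := mul_le_mul_of_nonneg_left h1 (by positivity : 0 ≤ 2 * (t / (2 * π)) * r * p)
    nlinarith

/-- `g_r(y) = f(y + r) - f(y)` for `f = phaseD t 0 = -(t/2π) log`. [folklore] -/
theorem dphase_zero_eq_phaseD_sub (t r y : ℝ) :
    dphase t r 0 y = phaseD t 0 (y + r) - phaseD t 0 y := by
  rw [dphase_zero, phaseD_zero, phaseD_zero]; ring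

/-- The differenced sum over `(a, b-r] ⊆ ℤ` is the sum of `e(g_r(n))` over the naturals
`(⌊a⌋₊, ⌊b-r⌋₊]` (`1 ≤ a`, `a + r ≤ b`). [folklore] -/
theorem diffSum_eq_natSum (t : ℝ) {a b : ℤ} {r : ℕ} (ha : 1 ≤ a) (harb : a + r ≤ b) :
    ∑ n ∈ Finset.Ioc a (b - r), e (phaseD t 0 ((n + r : ℤ)) - phaseD t 0 n)
      = ∑ n ∈ Finset.Ioc ⌊((a : ℤ) : ℝ)⌋₊ ⌊((b : ℤ) : ℝ) - r⌋₊, e (dphase t r 0 n) := by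
  have ha' : ((a.toNat : ℕ) : ℤ) = a := Int.toNat_of_nonneg (by omega)
  have hb' : (((b - r).toNat : ℕ) : ℤ) = b - r := Int.toNat_of_nonneg (by omega)
  have e_a : ⌊((a : ℤ) : ℝ)⌋₊ = a.toNat := by
    rw [show ((a : ℤ) : ℝ) = ((a.toNat : ℕ) : ℝ) by rw [← Int.cast_natCast, ha'], Nat.floor_natCast]
  have e_b : ⌊((b : ℤ) : ℝ) - r⌋₊ = (b - r).toNat := by
    have h1 : (((b - r).toNat : ℕ) : ℝ) = ((b - r : ℤ) : ℝ) := by exact_mod_cast hb'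
    have h2 : ((b : ℤ) : ℝ) - r = (((b - r).toNat : ℕ) : ℝ) := by rw [h1]; push_cast; ring
    rw [h2, Nat.floor_natCast]
  rw [e_a, e_b, ← ha', ← hb', sum_Ioc_int_eq_nat, ha', hb']
  refine Finset.sum_congr rfl fun n _ => ?_
  rw [dphase_zero_eq_phaseD_sub]
  push_cast
  ring_nf

/-- **The `B`-process bound for the differenced sum on a block** (Patel–Yang (3.16) with the
tree's `B`-process `…vanDerCorput_theorem49`, `‖𝔠‖ ≤ 3`, `A = h⁴`, `λ₂ = 2Kr/(ha)³`,
`λ₃ = 6Kr/(h⁴a⁴)`, and `…weightedDualSum_le`): for integers `1 ≤ a`, `a + r ≤ b ≤ ha`, `r ≥ 1`,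
`‖∑_{a<n≤b-r} e(f(n+r) - f(n))‖ ≤ 3 λ₂^{-1/2} (1 + yangKRHS η h¹³ 5 (β-α) λ₅')
  + 50h⁸ (λ₂^{-1/2} + log((b-r-a)λ₂ + 2) + (b-r-a)(λ₂λ₃)^{1/5})`. [cite: PatelYang2024, Lemma 3.4] -/
theorem diffSum_block_le {t h η : ℝ} (ht : 0 < t) (hh : 1 ≤ h) (hη : 0 < η) {a b : ℤ} {r : ℕ}
    (ha : 1 ≤ a) (hr : 1 ≤ r) (harb : a + r ≤ b) (hb : (b : ℝ) ≤ h * a) :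
    ‖∑ n ∈ Finset.Ioc a (b - r), e (phaseD t 0 ((n + r : ℤ)) - phaseD t 0 n)‖
      ≤ 3 * (Real.sqrt (2 * (t / (2 * π)) * r / (h * a) ^ 3))⁻¹
          * (1 + yangKRHS η (h ^ 13) 5 (dphase t r 1 a - dphase t r 1 ((b : ℝ) - r))
            (105 / 16 * (a : ℝ) ^ 9 / (h ^ 2 * (t / (2 * π)) ^ 4 * (r : ℝ) ^ 4)))
        + 50 * (h ^ 4) ^ 2 * (1 / Real.sqrt (2 * (t / (2 * π)) * r / (h * a) ^ 3)
          + Real.log ((((b : ℝ) - r) - a) * (2 * (t / (2 * π)) * r / (h * a) ^ 3) + 2)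
          + (((b : ℝ) - r) - a) * ((2 * (t / (2 * π)) * r / (h * a) ^ 3)
              * (6 * (t / (2 * π)) * r / (h ^ 4 * (a : ℝ) ^ 4))) ^ (1 / 5 : ℝ)) := by
  have hK : 0 < t / (2 * π) := by positivity
  have hh0 : 0 < h := by linarith
  have ha0 : (0 : ℝ) < a := by exact_mod_cast (show (0 : ℤ) < a by omega)
  have hr0 : (0 : ℝ) < r := by exact_mod_cast (show 0 < r by omega)
  have harb' : (a : ℝ) + r ≤ b := by exact_mod_cast harb
  have hbr : (a : ℝ) ≤ (b : ℝ) - r := by linarith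
  have hbr0 : (0 : ℝ) < (b : ℝ) - r := lt_of_lt_of_le ha0 hbr
  have hb0 : (0 : ℝ) < b := by linarith
  set lam2 : ℝ := 2 * (t / (2 * π)) * r / (h * a) ^ 3 with hlam2
  set lam3 : ℝ := 6 * (t / (2 * π)) * r / (h ^ 4 * (a : ℝ) ^ 4) with hlam3
  have hlam2pos : 0 < lam2 := by positivity
  have hlam3pos : 0 < lam3 := by positivity
  have hA : (1 : ℝ) ≤ h ^ 4 := one_le_pow₀ hh
  -- hypotheses of Theorem 4.9 for `f = g_r` on `[a, b - r]`
  have hf : ∀ x ∈ Icc (a : ℝ) ((b : ℝ) - r), HasDerivAt (dphase t r 0) (dphase t r 1 x) x :=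
    fun x hx => hasDerivAt_dphase t hr0.le (ha0.trans_le hx.1) 0
  have hf' : ∀ x ∈ Icc (a : ℝ) ((b : ℝ) - r), HasDerivAt (dphase t r 1) (dphase t r 2 x) x :=
    fun x hx => hasDerivAt_dphase t hr0.le (ha0.trans_le hx.1) 1
  have hf'' : ∀ x ∈ Icc (a : ℝ) ((b : ℝ) - r), HasDerivAt (dphase t r 2) (dphase t r 3 x) x :=
    fun x hx => hasDerivAt_dphase t hr0.le (ha0.trans_le hx.1) 2
  have hend := neg_dphase_two_end_ge ht hr0 (by linarith : (r : ℝ) < b)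
  have hb3 : lam2 ≤ 2 * (t / (2 * π)) * r / (b : ℝ) ^ 3 := by
    apply div_le_div_of_nonneg_left (by positivity) (by positivity)
    exact pow_le_pow_left₀ hb0.le hb 3
  have h2 : ∀ x ∈ Icc (a : ℝ) ((b : ℝ) - r), lam2 ≤ -dphase t r 2 x ∧ -dphase t r 2 x ≤ h ^ 4 * lam2 := by
    intro x hx
    have hx0 : 0 < x := ha0.trans_le hx.1
    constructor
    · have hmono := neg_dphase_two_antitone ht hr0 hx0 hx.2
      linarith
    · have hup := (dphase_two_three_abs_le ht hr0 hx0).1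
      have h1 : 2 * (t / (2 * π)) * r / x ^ 3 ≤ 2 * (t / (2 * π)) * r / (a : ℝ) ^ 3 := by
        apply div_le_div_of_nonneg_left (by positivity) (by positivity)
        exact pow_le_pow_left₀ ha0.le hx.1 3
      have h3 : 2 * (t / (2 * π)) * r / (a : ℝ) ^ 3 = h ^ 3 * lam2 := by
        rw [hlam2]; field_simp
      have h4 : h ^ 3 * lam2 ≤ h ^ 4 * lam2 :=
        mul_le_mul_of_nonneg_right (pow_le_pow_right₀ hh (by norm_num)) hlam2pos.le
      linarith
  have h3 : ∀ x ∈ Icc (a : ℝ) ((b : ℝ) - r), |dphase t r 3 x| ≤ h ^ 4 * lam3 := by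
    intro x hx
    have hx0 : 0 < x := ha0.trans_le hx.1
    have hup := (dphase_two_three_abs_le ht hr0 hx0).2
    have h1 : 6 * (t / (2 * π)) * r / x ^ 4 ≤ 6 * (t / (2 * π)) * r / (a : ℝ) ^ 4 := by
      apply div_le_div_of_nonneg_left (by positivity) (by positivity)
      exact pow_le_pow_left₀ ha0.le hx.1 4
    have h3' : 6 * (t / (2 * π)) * r / (a : ℝ) ^ 4 = h ^ 4 * lam3 := by
      rw [hlam3]; field_simp
    linarith
  have hα0 : 0 < dphase t r 1 ((b : ℝ) - r) := by
    rw [dphase_one]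
    have : ((b : ℝ) - r + r)⁻¹ < ((b : ℝ) - r)⁻¹ := by
      apply inv_strictAnti₀ hbr0; linarith
    nlinarith
  have hxs : ∀ ν : ℤ, dphase t r 1 ((b : ℝ) - r) < ν → (ν : ℝ) ≤ dphase t r 1 a →
      xsLog t r ν ∈ Icc (a : ℝ) ((b : ℝ) - r) ∧ dphase t r 1 (xsLog t r ν) = ν := by
    intro ν h1 h2
    exact ⟨xsLog_mem_Icc ht hr0 ha0 h1 h2 hbr, dphase_one_xsLog ht hr0 (hα0.trans h1)⟩
  have hT := vanDerCorput_theorem49 (xs := fun ν : ℤ => xsLog t r ν) ha0.le hbr hlam2pos hlam3pos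
    hA hf hf' hf'' h2 h3 hxs
  have hW := weightedDualSum_le ht hr0 ha0 harb' hb hh hη
  rw [diffSum_eq_natSum t ha harb]
  -- `‖S‖ ≤ ‖S - cW‖ + ‖c‖‖W‖`
  have hc := norm_bProcessConst_le
  calc ‖∑ n ∈ Finset.Ioc ⌊((a : ℤ) : ℝ)⌋₊ ⌊((b : ℤ) : ℝ) - r⌋₊, e (dphase t r 0 n)‖
      ≤ ‖∑ n ∈ Finset.Ioc ⌊((a : ℤ) : ℝ)⌋₊ ⌊((b : ℤ) : ℝ) - r⌋₊, e (dphase t r 0 n)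
          - bProcessConst * ∑ ν ∈ Finset.Ioc ⌊dphase t r 1 ((b : ℝ) - r)⌋ ⌊dphase t r 1 a⌋,
            (((Real.sqrt (-dphase t r 2 (xsLog t r ν)))⁻¹ : ℝ) : ℂ)
              * e (dphase t r 0 (xsLog t r ν) - ν * xsLog t r ν)‖
        + ‖bProcessConst * ∑ ν ∈ Finset.Ioc ⌊dphase t r 1 ((b : ℝ) - r)⌋ ⌊dphase t r 1 a⌋,
            (((Real.sqrt (-dphase t r 2 (xsLog t r ν)))⁻¹ : ℝ) : ℂ)
              * e (dphase t r 0 (xsLog t r ν) - ν * xsLog t r ν)‖ := norm_le_norm_sub_add _ _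
    _ ≤ 50 * (h ^ 4) ^ 2 * (1 / Real.sqrt lam2 + Real.log ((((b : ℝ) - r) - a) * lam2 + 2)
          + (((b : ℝ) - r) - a) * (lam2 * lam3) ^ (1 / 5 : ℝ))
        + 3 * ((Real.sqrt (2 * (t / (2 * π)) * r / (h * a) ^ 3))⁻¹
          * (1 + yangKRHS η (h ^ 13) 5 (dphase t r 1 a - dphase t r 1 ((b : ℝ) - r))
            (105 / 16 * (a : ℝ) ^ 9 / (h ^ 2 * (t / (2 * π)) ^ 4 * (r : ℝ) ^ 4)))) := by
        refine add_le_add hT ?_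
        rw [norm_mul]
        exact mul_le_mul hc hW (norm_nonneg _) (by norm_num)
    _ = _ := by ring


end VdC
end Literature.NumberTheory.LFunctions
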